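import Literature.Probability.LatticeModels.TriMeshTriCells
import Literature.Probability.LatticeModels.TriangularLatticeProofs
import HarnessLib

/-!
# Perfect hexagons and the punctured domain of the honeycomb mesh

Topic: Probability / LatticeModels (second file of the honeycomb twin `HexMesh*` of the series
"the largest mesh component of a Jordan domain is the bulk"; sub-namespace
`Literature.Probability.LatticeModels.HexMesh`). Everything is stated on the sites of the fine
triangular lattice `𝕋''` (`HexMeshCoord.lean`): the honeycomb vertices are the *non-centre*
sites `x` (`3 ∤ x₀ - x₁`), the hexagon centres the *centre* sites `s` (`3 ∣ s₀ - s₁`), and for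
a domain `Ω ⊆ ℂ` (in the embedded coordinates of `triMeshGraph`, sheared domain
`Ω' = triLinear ⁻¹' Ω`) the honeycomb mesh graph of `Ω` is the subgraph `G_N` of
`triMeshGraph Ω δ` induced on the non-centre mesh vertices.

* The hexagon of a centre site `s` is *perfect* (`HPs s`) if its six vertices (the
  `𝕋`-neighbours of `s`) are mesh vertices and its six sides (pairs of `𝕋`-adjacent neighbours)
  are mesh edges: `∀ y, s ∼ y → y ∈ triMeshVertices Ω δ ∧ ∀ y', s ∼ y' → y ∼ y' →
  (triMeshGraph Ω δ).Adj y y'`. No definitions are made: the predicate `HPs`, the punctured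
  domain `Ωp` and the vertex set `N` of the honeycomb graph enter every statement as variables
  together with the hypotheses `hHP`, `hΩp`, `hN` that they are given by the displayed formulas.
* The **punctured domain** `Ω⋆ = Ω ∖ {δ·triEmbed s | s a centre mesh vertex with imperfect
  hexagon}`. Its triangular mesh graph is the honeycomb mesh graph of `Ω` *plus* the centres of
  the perfect hexagons joined to their six vertices; hence (the point of the construction)
  reachability in `triMeshVertexGraph Ω⋆ δ` between non-centre sites is reachability in `G_N`
  (`GN_reachable_of_punct_reachable`: a walk through a perfect hexagon centre is re-routed
  around the hexagon), while all lemmas of the `TriMesh*` series stated for a general set apply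
  to `Ω⋆` verbatim.
* Book-keeping: `Ω⋆` is open and bounded with `Ω`, has the same closure (the punctures are
  finitely many points of the open set `Ω`), hence the same mesh edges and the same exterior;
  punctured centres are within `2δ` of `Ω'ᶜ` (an imperfect hexagon has a vertex off `Ω'` or a
  side leaving `Ω̄'`); a centre whose `2δ`-ball lies in `Ω'` has a perfect hexagon.

Folklore lattice geometry. Mathlib anchors: `SimpleGraph.induce`, `SimpleGraph.Walk`,
`Metric.infDist`, `mem_closure_iff_nhdsWithin_neBot`. H21 anchors: `triMeshGraph`,
`triMeshVertices`, `triMeshVertexGraph`, `Mesh.triGraph_adj_iff_coord'`,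
`triMeshGraph_adj_iff_shear`, `mem_triMeshVertices_iff_shear`, `triMeshVertices_finite_holds`.
-/

namespace Literature.Probability.LatticeModels.HexMesh

open Set Metric Complex Filter _root_.Topology Literature.Probability.LatticeModels
open Literature.Probability.LatticeModels.TriMesh

noncomputable section

variable {Ω : Set ℂ} {δ : ℝ}

/- Throughout: `HPs s` ↔ the hexagon of `s` is perfect; `Ωp` = the punctured domain; `N` = the
non-centre mesh vertices (the honeycomb vertices); `G_N = (triMeshGraph Ω δ).induce N`. The
defining hypotheses `hHP`, `hΩp`, `hN` are section variables, included where needed (they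
become the leading explicit arguments, in this order). -/
variable {HPs : Site 2 → Prop} {Ωp : Set ℂ} {N : Set (Site 2)}
variable
  (hHP : ∀ s : Site 2, HPs s ↔ ∀ y : Site 2, triGraph.Adj s y → y ∈ triMeshVertices Ω δ ∧
    ∀ y' : Site 2, triGraph.Adj s y' → triGraph.Adj y y' → (triMeshGraph Ω δ).Adj y y')
  (hΩp : Ωp = Ω \ triMeshPoint δ '' {s : Site 2 | (3 : ℤ) ∣ s 0 - s 1 ∧ s ∈ triMeshVertices Ω δ ∧ ¬ HPs s})
  (hN : N = {x : Site 2 | x ∈ triMeshVertices Ω δ ∧ ¬ (3 : ℤ) ∣ x 0 - x 1})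

/-! ### Mesh points -/

/-- `triMeshPoint δ` is injective for `δ ≠ 0`. [folklore] -/
theorem triMeshPoint_injective (hδ : δ ≠ 0) : Function.Injective (triMeshPoint δ) := by
  intro x y h
  rw [← triLinear_meshPoint, ← triLinear_meshPoint] at h
  exact Mesh.meshPoint_injective hδ (triLinear.injective h)

/-- Sheared mesh points of `𝕋`-neighbours are at distance `< 3δ/2` (`δ`, `δ` or `√2 δ`).
[folklore] -/
theorem dist_meshPoint_lt_of_triGraph_adj (hδ : 0 < δ) {x y : Site 2} (h : triGraph.Adj x y) :
    dist (meshPoint δ x) (meshPoint δ y) < 3 / 2 * δ := by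
  have hsq : dist (meshPoint δ x) (meshPoint δ y) ^ 2 ≤ 2 * δ ^ 2 := by
    rw [Complex.dist_eq, ← Complex.normSq_eq_norm_sq, Complex.normSq_apply, sub_re, sub_im,
      meshPoint_re, meshPoint_re, meshPoint_im, meshPoint_im]
    rw [Mesh.triGraph_adj_iff_coord'] at h
    rcases h with ⟨h0, h1⟩ | ⟨h0, h1⟩ | ⟨h0, h1⟩ | ⟨h0, h1⟩ | ⟨h0, h1⟩ | ⟨h0, h1⟩ <;>
      rw [h0, h1] <;> push_cast <;> nlinarith [sq_nonneg δ]
  have h94 : (2 : ℝ) * δ ^ 2 < (3 / 2 * δ) ^ 2 := by nlinarith [sq_nonneg δ, hδ]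
  exact lt_of_pow_lt_pow_left₀ 2 (by positivity) (hsq.trans_lt h94)

/-! ### Perfect hexagons -/

section HP
include hHP

/-- **A centre whose `2δ`-ball lies in `Ω'` has a perfect hexagon.** [folklore] -/
theorem hexPerfect_of_ball_subset (hδ : 0 < δ) {s : Site 2}
    (h : ball (meshPoint δ s) (2 * δ) ⊆ triLinear ⁻¹' Ω) : HPs s := by
  rw [hHP]
  intro y hy
  have hyb : meshPoint δ y ∈ ball (meshPoint δ s) (2 * δ) := by
    rw [mem_ball, dist_comm]; linarith [dist_meshPoint_lt_of_triGraph_adj hδ hy]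
  refine ⟨mem_triMeshVertices_iff_shear.2 (h hyb), fun y' hy' hyy' => ?_⟩
  have hyb' : meshPoint δ y' ∈ ball (meshPoint δ s) (2 * δ) := by
    rw [mem_ball, dist_comm]; linarith [dist_meshPoint_lt_of_triGraph_adj hδ hy']
  refine triMeshGraph_adj_iff_shear.2 ⟨hyy', ?_⟩
  exact ((convex_ball _ _).segment_subset hyb hyb').trans (h.trans subset_closure)

/-- A centre at distance `≥ 2δ` from `Ω'ᶜ` has a perfect hexagon. [folklore] -/
theorem hexPerfect_of_le_infDist (hδ : 0 < δ) {s : Site 2}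
    (h : 2 * δ ≤ infDist (meshPoint δ s) (triLinear ⁻¹' Ω)ᶜ) : HPs s :=
  hexPerfect_of_ball_subset hHP hδ ((ball_subset_ball h).trans ball_infDist_compl_subset)

/-- **An imperfect hexagon has a defect within `3δ/2` of its centre**: a point of `Ω'ᶜ`.
[folklore] -/
theorem exists_not_mem_of_not_hexPerfect (hδ : 0 < δ) {s : Site 2} (h : ¬ HPs s) :
    ∃ p ∈ (triLinear ⁻¹' Ω)ᶜ, dist (meshPoint δ s) p < 3 / 2 * δ := by
  rw [hHP] at h
  simp only [not_forall, not_and, exists_prop] at h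
  obtain ⟨y, hy, hdef⟩ := h
  by_cases hyv : y ∈ triMeshVertices Ω δ
  · obtain ⟨y', hy', hyy', hadj⟩ := hdef hyv
    rw [triMeshGraph_adj_iff_shear, not_and] at hadj
    obtain ⟨p, hp, hpΩ⟩ := not_subset.1 (hadj hyy')
    refine ⟨p, fun hpΩ' => hpΩ (subset_closure hpΩ'), ?_⟩
    have hball : segment ℝ (meshPoint δ y) (meshPoint δ y') ⊆ ball (meshPoint δ s) (3 / 2 * δ) :=
      (convex_ball _ _).segment_subset
        (by rw [mem_ball, dist_comm]; exact dist_meshPoint_lt_of_triGraph_adj hδ hy)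
        (by rw [mem_ball, dist_comm]; exact dist_meshPoint_lt_of_triGraph_adj hδ hy')
    have := hball hp
    rwa [mem_ball, dist_comm] at this
  · exact ⟨meshPoint δ y, fun h' => hyv (mem_triMeshVertices_iff_shear.2 h'),
      dist_meshPoint_lt_of_triGraph_adj hδ hy⟩

/-- **Punctured centres are shallow**: an imperfect hexagon centre is at distance `< 3δ/2` from
`Ω'ᶜ`. [folklore] -/
theorem infDist_lt_of_not_hexPerfect (hδ : 0 < δ) {s : Site 2} (h : ¬ HPs s) :
    infDist (meshPoint δ s) (triLinear ⁻¹' Ω)ᶜ < 3 / 2 * δ := by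
  obtain ⟨p, hp, hd⟩ := exists_not_mem_of_not_hexPerfect hHP hδ h
  exact (infDist_le_dist_of_mem hp).trans_lt hd

end HP

/-! ### The punctured domain -/

/-- The set of punctures is finite (bounded `Ω`, `δ > 0`). [folklore] -/
theorem punctures_finite (hΩb : Bornology.IsBounded Ω) (hδ : 0 < δ) :
    (triMeshPoint δ '' {s : Site 2 | (3 : ℤ) ∣ s 0 - s 1 ∧ s ∈ triMeshVertices Ω δ ∧ ¬ HPs s}).Finite :=
  ((triMeshVertices_finite_holds hΩb hδ).subset fun _ hs => hs.2.1).image _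

/-- Removing finitely many points from an open set of the plane does not change its closure.
[folklore] -/
theorem closure_diff_finite_eq {U F : Set ℂ} (hU : IsOpen U) (hF : F.Finite) : closure (U \ F) = closure U := by
  refine (closure_mono Set.sdiff_subset).antisymm ?_
  refine closure_minimal (fun z hz => ?_) isClosed_closure
  -- the punctured neighbourhood filter at `z` is nontrivial and contains `U \ F`
  rw [mem_closure_iff_nhdsWithin_neBot]
  have hmem : U \ F ∈ 𝓝[≠] z := by
    have h1 : U ∈ 𝓝[≠] z := mem_nhdsWithin_of_mem_nhds (hU.mem_nhds hz)
    have h2 : (F \ {z})ᶜ ∈ 𝓝 z :=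
      (hF.subset Set.sdiff_subset).isClosed.isOpen_compl.mem_nhds (fun h => h.2 rfl)
    have h3 : {z}ᶜ ∩ (F \ {z})ᶜ ∈ 𝓝[≠] z := inter_mem_nhdsWithin _ h2
    filter_upwards [h1, h3] with w hw1 hw2
    refine ⟨hw1, fun hwF => ?_⟩
    exact hw2.2 ⟨hwF, hw2.1⟩
  have hle : 𝓝[≠] z ≤ 𝓝[U \ F] z :=
    le_inf nhdsWithin_le_nhds (le_principal_iff.2 hmem)
  exact Filter.NeBot.mono inferInstance hle

section Punct
include hΩp

/-- The punctured domain is contained in the domain. [folklore] -/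
theorem punct_subset : Ωp ⊆ Ω := by rw [hΩp]; exact Set.sdiff_subset

/-- The punctured domain is open (open `Ω`, bounded, `δ > 0`). [folklore] -/
theorem isOpen_punct (hΩo : IsOpen Ω) (hΩb : Bornology.IsBounded Ω) (hδ : 0 < δ) : IsOpen Ωp := by
  rw [hΩp]; exact hΩo.sdiff (punctures_finite hΩb hδ).isClosed

/-- The punctured domain is bounded. [folklore] -/
theorem isBounded_punct (hΩb : Bornology.IsBounded Ω) : Bornology.IsBounded Ωp := by
  rw [hΩp]; exact hΩb.subset Set.sdiff_subset

/-- **The punctured domain has the same closure** (open bounded `Ω`, `δ > 0`). [folklore] -/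
theorem closure_punct (hΩo : IsOpen Ω) (hΩb : Bornology.IsBounded Ω) (hδ : 0 < δ) :
    closure Ωp = closure Ω := by
  rw [hΩp]; exact closure_diff_finite_eq hΩo (punctures_finite hΩb hδ)

/-- Sheared form: the sheared punctured domain has the same closure as `Ω'`. [folklore] -/
theorem closure_preimage_punct (hΩo : IsOpen Ω) (hΩb : Bornology.IsBounded Ω) (hδ : 0 < δ) :
    closure (triLinear ⁻¹' Ωp) = closure (triLinear ⁻¹' Ω) := by
  rw [← triLinear_preimage_closure, ← triLinear_preimage_closure, closure_punct hΩp hΩo hΩb hδ]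

/-- **Mesh edges of the punctured domain are the mesh edges of `Ω`.** [folklore] -/
theorem triMeshGraph_punct_adj_iff (hΩo : IsOpen Ω) (hΩb : Bornology.IsBounded Ω) (hδ : 0 < δ)
    {x y : Site 2} : (triMeshGraph Ωp δ).Adj x y ↔ (triMeshGraph Ω δ).Adj x y := by
  rw [triMeshGraph_adj_iff, triMeshGraph_adj_iff, closure_punct hΩp hΩo hΩb hδ]

/-- **Mesh vertices of the punctured domain**: the mesh vertices of `Ω`, except the centres with
an imperfect hexagon. [folklore] -/
theorem mem_triMeshVertices_punct_iff (hδ : 0 < δ) {x : Site 2} :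
    x ∈ triMeshVertices Ωp δ ↔ x ∈ triMeshVertices Ω δ ∧ ((3 : ℤ) ∣ x 0 - x 1 → HPs x) := by
  rw [hΩp, mem_triMeshVertices_iff, Set.mem_sdiff, mem_triMeshVertices_iff]
  refine and_congr_right fun hx => ?_
  constructor
  · intro hnot h3
    by_contra hP
    exact hnot ⟨x, ⟨h3, hx, hP⟩, rfl⟩
  · rintro himp ⟨s, ⟨h3, -, hP⟩, hs⟩
    obtain rfl := triMeshPoint_injective hδ.ne' hs
    exact hP (himp h3)

/-- Non-centre mesh vertices of `Ω` are mesh vertices of the punctured domain. [folklore] -/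
theorem mem_triMeshVertices_punct_of_not_dvd (hδ : 0 < δ) {x : Site 2} (hx : x ∈ triMeshVertices Ω δ)
    (h3 : ¬ (3 : ℤ) ∣ x 0 - x 1) : x ∈ triMeshVertices Ωp δ :=
  (mem_triMeshVertices_punct_iff hΩp hδ).2 ⟨hx, fun h => absurd h h3⟩

/-- A centre mesh vertex of the punctured domain has a perfect hexagon. [folklore] -/
theorem hexPerfect_of_mem_punct (hδ : 0 < δ) {s : Site 2} (hs : s ∈ triMeshVertices Ωp δ)
    (h3 : (3 : ℤ) ∣ s 0 - s 1) : HPs s :=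
  ((mem_triMeshVertices_punct_iff hΩp hδ).1 hs).2 h3

end Punct

section PunctHP
include hHP hΩp

/-- **Punctures are shallow**: a puncture is within `3δ/2` of `Ω'ᶜ` (sheared coordinates), so the
inner collar of the sheared punctured domain of width `r` lies in the inner collar of `Ω'` of
width `r + 3δ/2`. [folklore] -/
theorem infDist_compl_lt_of_infDist_punct_lt (hδ : 0 < δ) {z : ℂ} {r : ℝ}
    (hne : (triLinear ⁻¹' Ωp)ᶜ.Nonempty) (hz : infDist z (triLinear ⁻¹' Ωp)ᶜ < r) :
    infDist z (triLinear ⁻¹' Ω)ᶜ < r + 3 / 2 * δ := by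
  rw [infDist_lt_iff hne] at hz
  obtain ⟨y, hy, hzy⟩ := hz
  rw [hΩp, mem_compl_iff, mem_preimage, Set.mem_sdiff, not_and_or, not_not] at hy
  rcases hy with hy | hy
  · have : infDist z (triLinear ⁻¹' Ω)ᶜ ≤ dist z y := infDist_le_dist_of_mem hy
    linarith
  · obtain ⟨s, ⟨-, -, hP⟩, hs⟩ := hy
    have hys : y = meshPoint δ s := triLinear.injective (by rw [triLinear_meshPoint, hs])
    subst hys
    have h1 := infDist_lt_of_not_hexPerfect hHP hδ hP
    have h2 := infDist_le_infDist_add_dist (s := (triLinear ⁻¹' Ω)ᶜ) (x := z) (y := meshPoint δ s)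
    linarith

end PunctHP

/-! ### The honeycomb mesh graph inside the mesh graph of the punctured domain -/

section GN1
include hΩp hN

/-- **`G_N` is a subgraph of the mesh vertex graph of the punctured domain**: reachability
transfers. [folklore] -/
theorem punct_reachable_of_GN_reachable (hΩo : IsOpen Ω) (hΩb : Bornology.IsBounded Ω) (hδ : 0 < δ)
    {x y : N} (h : ((triMeshGraph Ω δ).induce N).Reachable x y) :
    ∃ (hx : (x : Site 2) ∈ triMeshVertices Ωp δ) (hy : (y : Site 2) ∈ triMeshVertices Ωp δ),
      (triMeshVertexGraph Ωp δ).Reachable ⟨x.1, hx⟩ ⟨y.1, hy⟩ := by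
  have hmem : ∀ v : N, (v : Site 2) ∈ triMeshVertices Ωp δ := fun v => by
    have hv : (v : Site 2) ∈ {x : Site 2 | x ∈ triMeshVertices Ω δ ∧ ¬ (3 : ℤ) ∣ x 0 - x 1} := hN ▸ v.2
    exact mem_triMeshVertices_punct_of_not_dvd hΩp hδ hv.1 hv.2
  let f : (triMeshGraph Ω δ).induce N →g triMeshVertexGraph Ωp δ :=
    { toFun := fun v => ⟨v.1, hmem v⟩
      map_rel' := fun hab => (triMeshGraph_punct_adj_iff hΩp hΩo hΩb hδ).2 hab }
  exact ⟨hmem x, hmem y, h.map f⟩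

end GN1

/-- The six `𝕋`-neighbours of a site, as a list in cyclic order around it; consecutive ones (and
the last and the first) are `𝕋`-adjacent. [folklore] -/
theorem triGraph_adj_iff_mem_six (s y : Site 2) :
    triGraph.Adj s y ↔
      y = ![s 0 + 1, s 1] ∨ y = ![s 0, s 1 + 1] ∨ y = ![s 0 - 1, s 1 + 1] ∨
        y = ![s 0 - 1, s 1] ∨ y = ![s 0, s 1 - 1] ∨ y = ![s 0 + 1, s 1 - 1] := by
  rw [Mesh.triGraph_adj_iff_coord']
  have key : ∀ a b : ℤ, y = ![a, b] ↔ y 0 = a ∧ y 1 = b := fun a b =>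
    ⟨fun h => by subst h; simp, fun h => Mesh.site2_ext' (by simp [h.1]) (by simp [h.2])⟩
  simp only [key]
  tauto

section GN2
include hHP hN

/-- In a perfect hexagon two consecutive vertices are joined in `G_N` (they are non-centre mesh
vertices of `Ω` joined by a mesh edge). [folklore] -/
theorem GN_adj_of_hexPerfect {s : Site 2} (hP : HPs s) (h3 : (3 : ℤ) ∣ s 0 - s 1)
    {y y' : Site 2} (hy : triGraph.Adj s y) (hy' : triGraph.Adj s y') (hyy' : triGraph.Adj y y') :
    ∃ (hyN : y ∈ N)
      (hy'N : y' ∈ N),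
      ((triMeshGraph Ω δ).induce N).Adj ⟨y, hyN⟩ ⟨y', hy'N⟩ := by
  have h3y : ¬ (3 : ℤ) ∣ y 0 - y 1 := by
    rw [Mesh.triGraph_adj_iff_coord'] at hy; rcases hy with h | h | h | h | h | h <;> omega
  have h3y' : ¬ (3 : ℤ) ∣ y' 0 - y' 1 := by
    rw [Mesh.triGraph_adj_iff_coord'] at hy'; rcases hy' with h | h | h | h | h | h <;> omega
  rw [hHP] at hP
  subst hN
  exact ⟨⟨(hP y hy).1, h3y⟩, ⟨(hP y' hy').1, h3y'⟩, (hP y hy).2 y' hy' hyy'⟩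

/-- **Walking around a perfect hexagon**: any two vertices of a perfect hexagon are joined in
`G_N`. [folklore] -/
theorem GN_reachable_of_hexPerfect {s : Site 2} (hP : HPs s) (h3 : (3 : ℤ) ∣ s 0 - s 1)
    {u u' : Site 2} (hu : triGraph.Adj s u) (hu' : triGraph.Adj s u') :
    ∃ (huN : u ∈ N)
      (hu'N : u' ∈ N),
      ((triMeshGraph Ω δ).induce N).Reachable ⟨u, huN⟩ ⟨u', hu'N⟩ := by
  -- the six vertices in cyclic order
  set v₀ : Site 2 := ![s 0 + 1, s 1] with hv₀
  set v₁ : Site 2 := ![s 0, s 1 + 1] with hv₁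
  set v₂ : Site 2 := ![s 0 - 1, s 1 + 1] with hv₂
  set v₃ : Site 2 := ![s 0 - 1, s 1] with hv₃
  set v₄ : Site 2 := ![s 0, s 1 - 1] with hv₄
  set v₅ : Site 2 := ![s 0 + 1, s 1 - 1] with hv₅
  have a₀ : triGraph.Adj s v₀ := (triGraph_adj_iff_mem_six s _).2 (Or.inl rfl)
  have a₁ : triGraph.Adj s v₁ := (triGraph_adj_iff_mem_six s _).2 (Or.inr (Or.inl rfl))
  have a₂ : triGraph.Adj s v₂ := (triGraph_adj_iff_mem_six s _).2 (Or.inr (Or.inr (Or.inl rfl)))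
  have a₃ : triGraph.Adj s v₃ := (triGraph_adj_iff_mem_six s _).2 (Or.inr (Or.inr (Or.inr (Or.inl rfl))))
  have a₄ : triGraph.Adj s v₄ :=
    (triGraph_adj_iff_mem_six s _).2 (Or.inr (Or.inr (Or.inr (Or.inr (Or.inl rfl)))))
  have a₅ : triGraph.Adj s v₅ :=
    (triGraph_adj_iff_mem_six s _).2 (Or.inr (Or.inr (Or.inr (Or.inr (Or.inr rfl)))))
  have e₀₁ : triGraph.Adj v₀ v₁ := by rw [Mesh.triGraph_adj_iff_coord']; simp [hv₀, hv₁]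
  have e₁₂ : triGraph.Adj v₁ v₂ := by rw [Mesh.triGraph_adj_iff_coord']; simp [hv₁, hv₂]
  have e₂₃ : triGraph.Adj v₂ v₃ := by rw [Mesh.triGraph_adj_iff_coord']; simp [hv₂, hv₃]
  have e₃₄ : triGraph.Adj v₃ v₄ := by rw [Mesh.triGraph_adj_iff_coord']; simp [hv₃, hv₄]
  have e₄₅ : triGraph.Adj v₄ v₅ := by rw [Mesh.triGraph_adj_iff_coord']; simp [hv₄, hv₅]
  -- consecutive vertices are `G_N`-adjacent
  obtain ⟨n₀, n₁, g₀₁⟩ := GN_adj_of_hexPerfect hHP hN hP h3 a₀ a₁ e₀₁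
  obtain ⟨m₁, n₂, g₁₂⟩ := GN_adj_of_hexPerfect hHP hN hP h3 a₁ a₂ e₁₂
  obtain ⟨m₂, n₃, g₂₃⟩ := GN_adj_of_hexPerfect hHP hN hP h3 a₂ a₃ e₂₃
  obtain ⟨m₃, n₄, g₃₄⟩ := GN_adj_of_hexPerfect hHP hN hP h3 a₃ a₄ e₃₄
  obtain ⟨m₄, n₅, g₄₅⟩ := GN_adj_of_hexPerfect hHP hN hP h3 a₄ a₅ e₄₅
  -- every vertex is reachable from `v₀`
  have r₁ : ((triMeshGraph Ω δ).induce N).Reachable ⟨v₀, n₀⟩ ⟨v₁, n₁⟩ := g₀₁.reachable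
  have r₂ : ((triMeshGraph Ω δ).induce N).Reachable ⟨v₀, n₀⟩ ⟨v₂, n₂⟩ := r₁.trans g₁₂.reachable
  have r₃ : ((triMeshGraph Ω δ).induce N).Reachable ⟨v₀, n₀⟩ ⟨v₃, n₃⟩ := r₂.trans g₂₃.reachable
  have r₄ : ((triMeshGraph Ω δ).induce N).Reachable ⟨v₀, n₀⟩ ⟨v₄, n₄⟩ := r₃.trans g₃₄.reachable
  have r₅ : ((triMeshGraph Ω δ).induce N).Reachable ⟨v₀, n₀⟩ ⟨v₅, n₅⟩ := r₄.trans g₄₅.reachable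
  have hall : ∀ u, triGraph.Adj s u →
      ∃ huN : u ∈ N,
        ((triMeshGraph Ω δ).induce N).Reachable ⟨v₀, n₀⟩ ⟨u, huN⟩ := by
    intro u hu
    rcases (triGraph_adj_iff_mem_six s u).1 hu with rfl | rfl | rfl | rfl | rfl | rfl
    · exact ⟨n₀, SimpleGraph.Reachable.refl _⟩
    · exact ⟨n₁, r₁⟩
    · exact ⟨n₂, r₂⟩
    · exact ⟨n₃, r₃⟩
    · exact ⟨n₄, r₄⟩
    · exact ⟨n₅, r₅⟩
  obtain ⟨huN, ru⟩ := hall u hu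
  obtain ⟨hu'N, ru'⟩ := hall u' hu'
  exact ⟨huN, hu'N, ru.symm.trans ru'⟩

end GN2

section GN3
include hHP hΩp hN

/-- **Re-routing around perfect hexagons.** Let `z` be a mesh vertex of the punctured domain and
`x` a non-centre one, joined in `triMeshVertexGraph Ω⋆ δ`. Then either `z` is a non-centre site
joined to `x` in the honeycomb mesh graph `G_N` of `Ω`, or `z` is a centre site `𝕋`-adjacent to
a non-centre site joined to `x` in `G_N`. (Induction along the walk; a step through a centre,
whose hexagon is perfect since the centre is a vertex of `Ω⋆`, is replaced by a walk around the
hexagon.) [folklore] -/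
theorem GN_reachable_of_punct_reachable (hΩo : IsOpen Ω) (hΩb : Bornology.IsBounded Ω) (hδ : 0 < δ)
    {x : Site 2} (hx : x ∈ N)
    {hx' : x ∈ triMeshVertices Ωp δ} {z : triMeshVertices Ωp δ}
    (h : (triMeshVertexGraph Ωp δ).Reachable ⟨x, hx'⟩ z) :
    (∃ hz : (z : Site 2) ∈ N,
        ((triMeshGraph Ω δ).induce N).Reachable ⟨x, hx⟩ ⟨z, hz⟩) ∨
      ((3 : ℤ) ∣ (z : Site 2) 0 - (z : Site 2) 1 ∧
        ∃ (z' : Site 2) (hz' : z' ∈ N),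
          triGraph.Adj z z' ∧ ((triMeshGraph Ω δ).induce N).Reachable ⟨x, hx⟩ ⟨z', hz'⟩) := by
  -- induct along a walk from `z` to `x`, keeping the end `x` fixed
  obtain ⟨W⟩ := h.symm
  suffices key : ∀ (a : triMeshVertices Ωp δ) (W : (triMeshVertexGraph Ωp δ).Walk a ⟨x, hx'⟩),
      (∃ ha : (a : Site 2) ∈ N,
          ((triMeshGraph Ω δ).induce N).Reachable ⟨x, hx⟩ ⟨a, ha⟩) ∨
        ((3 : ℤ) ∣ (a : Site 2) 0 - (a : Site 2) 1 ∧
          ∃ (a' : Site 2) (ha' : a' ∈ N),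
            triGraph.Adj a a' ∧ ((triMeshGraph Ω δ).induce N).Reachable ⟨x, hx⟩ ⟨a', ha'⟩) from key z W
  intro a W
  -- generalise the endpoint to run the induction
  suffices key' : ∀ (a b : triMeshVertices Ωp δ) (W : (triMeshVertexGraph Ωp δ).Walk a b),
      b = ⟨x, hx'⟩ →
      (∃ ha : (a : Site 2) ∈ N,
          ((triMeshGraph Ω δ).induce N).Reachable ⟨x, hx⟩ ⟨a, ha⟩) ∨
        ((3 : ℤ) ∣ (a : Site 2) 0 - (a : Site 2) 1 ∧
          ∃ (a' : Site 2) (ha' : a' ∈ N),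
            triGraph.Adj a a' ∧ ((triMeshGraph Ω δ).induce N).Reachable ⟨x, hx⟩ ⟨a', ha'⟩) from key' a _ W rfl
  intro a b W
  induction W with
  | nil =>
    rintro rfl
    exact Or.inl ⟨hx, SimpleGraph.Reachable.refl _⟩
  | @cons a b c hab W ih =>
    rintro rfl
    have hab' : (triMeshGraph Ω δ).Adj a b := (triMeshGraph_punct_adj_iff hΩp hΩo hΩb hδ).1 hab
    have habT : triGraph.Adj a b := triMeshGraph_le_triGraph Ω δ hab'
    have haΩ : (a : Site 2) ∈ triMeshVertices Ω δ := ((mem_triMeshVertices_punct_iff hΩp hδ).1 a.2).1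
    rcases ih rfl with ⟨hb, hrb⟩ | ⟨h3b, b', hb', hbb', hrb'⟩
    · -- `b` is a non-centre site joined to `x`
      by_cases h3a : (3 : ℤ) ∣ (a : Site 2) 0 - (a : Site 2) 1
      · exact Or.inr ⟨h3a, b, hb, habT, hrb⟩
      · have haN : (a : Site 2) ∈ N := by rw [hN]; exact ⟨haΩ, h3a⟩
        refine Or.inl ⟨haN, hrb.trans ?_⟩
        have : ((triMeshGraph Ω δ).induce N).Adj ⟨b, hb⟩ ⟨a, haN⟩ := hab'.symm
        exact this.reachable
    · -- `b` is a perfect hexagon centre: go around it to `b'`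
      have hPb : HPs (b : Site 2) := hexPerfect_of_mem_punct hΩp hδ b.2 h3b
      obtain ⟨haN, hb'N, hr⟩ := GN_reachable_of_hexPerfect hHP hN hPb h3b habT.symm hbb'
      exact Or.inl ⟨haN, hrb'.trans hr.symm⟩

end GN3

/-- Reachability in the mesh vertex graph is monotone in the domain when the closures agree on
the relevant edges; here: from the punctured domain of a smaller set to that of... (plain
monotonicity for `triMeshVertexGraph`). [folklore] -/
theorem triMeshVertexGraph_reachable_mono {Ω₁ Ω₂ : Set ℂ} (hsub : Ω₁ ⊆ Ω₂)
    {x y : Site 2} {hx : x ∈ triMeshVertices Ω₁ δ} {hy : y ∈ triMeshVertices Ω₁ δ}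
    (h : (triMeshVertexGraph Ω₁ δ).Reachable ⟨x, hx⟩ ⟨y, hy⟩) :
    (triMeshVertexGraph Ω₂ δ).Reachable ⟨x, hsub hx⟩ ⟨y, hsub hy⟩ := by
  let f : triMeshVertexGraph Ω₁ δ →g triMeshVertexGraph Ω₂ δ :=
    { toFun := fun v => ⟨v.1, hsub v.2⟩
      map_rel' := fun hab => by
        have hab' := triMeshGraph_adj_iff.1 hab
        exact triMeshGraph_adj_iff.2 ⟨hab'.1, hab'.2.trans (closure_mono hsub)⟩ }
  exact h.map f

end

end Literature.Probability.LatticeModels.HexMesh
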